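import Summits.AtomisticToContinuum.HydrodynamicLimit.Theorems.JParityClosureLocalSecondLawContactDefs

/-!
# Entropy-flux gap of the line `contact-asymmetry-information` (crux `LocalSecondLaw`,
stmt-AtomisticToContinuum-13081) — stub K4 `stub_entropyFluxClosure`: the algebraic split of the integrand

Stub K4 asks `|fluxGapEns| ≤ η` for the one-particle densities of pinned bounded tilts of the local Gibbs law,
`fluxGapEns = ensX − ∫₀^τ∫ ∑ₖ j̄_kin,k ∂ₖφ = ∫₀^τ∫ ∑ₖ (Hs(ρ̄,θ̄) ūₖ − j̄_kin,k) ∂ₖφ` (two Bochner integrals).  With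
`h̄_kin = h̄ + c₀ρ̄ + ρ̄ f_ex(ρ̄σ³)` and `j̄_kin = j̄ + (c₀ρ̄ + ρ̄ f_ex(ρ̄σ³)) ū` the `f_ex`/`c₀` terms CANCEL in the
combination `Hs ūₖ − j̄_kin,k`, which splits POINTWISE in `(s, x)` into

* a MAXWELLISATION term `(Hs(ρ̄,θ̄) − h̄_kin) ūₖ` — the integrand of stub M (`maxwellGapEns`) in the weight `ū·∇φ`
  instead of `∂ₛφ`, and
* the CONDUCTIVE kinetic entropy flux `j̄ₖ − h̄ ūₖ = b_r ∗ ∫ (vₖ − ūₖ(s,x)) f log f dv` relative to the mean coarse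
  velocity — the term containing `−q̄/θ` (heat flux over temperature, a CUBIC velocity moment) plus
  `∫ (v − u) f log (f/M_f) dv`; this is the weak cubic closure of the crux (HighMomentumCutoff class).

This file lands the split as identities of the part-A vocabulary (`contactK4_flux_split`, registered on the item;
`contactK4_integrand_split`, the same identity summed against `∇φ` in the exact shape of the `ensX` integrand) and
the resulting expression of `fluxGapEns` as ONE double integral of the split integrand under the four integrability
hypotheses that make both Bochner integrals honest (`contactK4_fluxGapEns_eq_integral_split`).  This is how a
composition consumes "M in `|ū||∇φ|`-weight" plus a conductive-flux bound; no closure is claimed here.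

References: H. Spohn, *Large Scale Dynamics of Interacting Particles* (1991), Part I §3 (local equilibrium, entropy
flux `hu − q/θ`); P. Résibois, J. Stat. Phys. 19 (1978) 593 (H-theorem for the Enskog equation, the `f_ex` offset);
S. R. S. Varadhan, *Entropy methods in hydrodynamic scaling*, LNM 1551 (1993) §5 (the cubic obstruction).
-/

noncomputable section

open scoped BigOperators Topology Classical MeasureTheory ENNReal InnerProductSpace
open Filter Set MeasureTheory Function
open Literature.MathematicalPhysics.KineticTheory
open Literature.Analysis.FluidPDE
open Summit.AtomisticToContinuum.HydrodynamicLimit.Theorems.LocalSecondLawNegative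
open Summit.AtomisticToContinuum.HydrodynamicLimit.Theorems.LocalSecondLawLedger

namespace Summit.AtomisticToContinuum.HydrodynamicLimit.Theorems.LocalSecondLawContact

/-- **K4 split, pointwise** (registered `contactK4_flux_split`): for every component `k`,
`Hs(ρ̄,θ̄) ūₖ − j̄_kin,k = (Hs(ρ̄,θ̄) − h̄_kin) ūₖ − (j̄ₖ − h̄ ūₖ)` — the `c₀ρ̄ ū` and `ρ̄ f_ex(ρ̄σ³) ū` terms of
`h̄_kin ū` and `j̄_kin` cancel (`ring` over the definitions of `hKinBar`, `jKinBar`). -/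
theorem contactK4_flux_split : ∀ {N : ℕ} (σ r : ℝ) (f : Pt1 → ℝ) (ν : Measure (Phase N)) (Φ : Flow σ N) (s : ℝ) (x : T3) (k : Fin 3), Hs σ (rhoBar r ν Φ s x) (thetaBar r ν Φ s x) * uBar r ν Φ s x k - jKinBar σ r f ν Φ s x k = (Hs σ (rhoBar r ν Φ s x) (thetaBar r ν Φ s x) - hKinBar σ r f ν Φ s x) * uBar r ν Φ s x k - (jBar r f s x k - hBar r f s x * uBar r ν Φ s x k) := by
  intro N σ r f ν Φ s x k
  unfold jKinBar hKinBar
  ring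

/-- **K4 split of the integrand** (summed against `∇φ`, in the exact shape of the `ensX` and `kinWeakForm`
integrands): `Hs(ρ̄,θ̄) ∑ₖ ūₖ∂ₖφ − ∑ₖ j̄_kin,k ∂ₖφ = ∑ₖ (Hs − h̄_kin) ūₖ ∂ₖφ − ∑ₖ (j̄ₖ − h̄ ūₖ) ∂ₖφ`. -/
theorem contactK4_integrand_split {N : ℕ} (σ r : ℝ) (φ : ℝ → T3 → ℝ) (f : Pt1 → ℝ) (ν : Measure (Phase N))
    (Φ : Flow σ N) (s : ℝ) (x : T3) :
    Hs σ (rhoBar r ν Φ s x) (thetaBar r ν Φ s x) * ∑ k : Fin 3, uBar r ν Φ s x k * pD k (φ s) x -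
        ∑ k : Fin 3, jKinBar σ r f ν Φ s x k * pD k (φ s) x =
      (∑ k : Fin 3, (Hs σ (rhoBar r ν Φ s x) (thetaBar r ν Φ s x) - hKinBar σ r f ν Φ s x) *
          uBar r ν Φ s x k * pD k (φ s) x) -
        ∑ k : Fin 3, (jBar r f s x k - hBar r f s x * uBar r ν Φ s x k) * pD k (φ s) x := by
  rw [Finset.mul_sum, ← Finset.sum_sub_distrib, ← Finset.sum_sub_distrib]
  refine Finset.sum_congr rfl fun k _ => ?_
  have h := contactK4_flux_split σ r f ν Φ s x k
  calc Hs σ (rhoBar r ν Φ s x) (thetaBar r ν Φ s x) * (uBar r ν Φ s x k * pD k (φ s) x) -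
          jKinBar σ r f ν Φ s x k * pD k (φ s) x
        = (Hs σ (rhoBar r ν Φ s x) (thetaBar r ν Φ s x) * uBar r ν Φ s x k - jKinBar σ r f ν Φ s x k) *
            pD k (φ s) x := by ring
    _ = ((Hs σ (rhoBar r ν Φ s x) (thetaBar r ν Φ s x) - hKinBar σ r f ν Φ s x) * uBar r ν Φ s x k -
            (jBar r f s x k - hBar r f s x * uBar r ν Φ s x k)) * pD k (φ s) x := by rw [h]
    _ = _ := by ring

/-- **`fluxGapEns` as one double integral of the split integrand.**  If the two Bochner integrals entering
`fluxGapEns` are honest — the `ensX` integrand and the `j̄_kin·∇φ` integrand are integrable in `x` at every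
`s ∈ [0,τ]`, and their `x`-integrals are integrable in `s` on `[0,τ]` — then
`fluxGapEns = ∫₀^τ∫ [∑ₖ (Hs − h̄_kin) ūₖ ∂ₖφ − ∑ₖ (j̄ₖ − h̄ ūₖ) ∂ₖφ]`: Maxwellisation in `ū·∇φ`-weight minus the pairing
of the conductive kinetic entropy flux.  (Splitting the right-hand side into two integrals needs, in addition, the
integrability of either part.) -/
theorem contactK4_fluxGapEns_eq_integral_split {N : ℕ} (σ r τ : ℝ) (φ : ℝ → T3 → ℝ) (f : Pt1 → ℝ)
    (ν : Measure (Phase N)) (Φ : Flow σ N)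
    (hXs : IntegrableOn (fun s => ∫ x : T3, Hs σ (rhoBar r ν Φ s x) (thetaBar r ν Φ s x) *
        ∑ k : Fin 3, uBar r ν Φ s x k * pD k (φ s) x) (Set.Icc (0 : ℝ) τ))
    (hJs : IntegrableOn (fun s => ∫ x : T3, ∑ k : Fin 3, jKinBar σ r f ν Φ s x k * pD k (φ s) x)
        (Set.Icc (0 : ℝ) τ))
    (hXx : ∀ s ∈ Set.Icc (0 : ℝ) τ, Integrable fun x : T3 => Hs σ (rhoBar r ν Φ s x) (thetaBar r ν Φ s x) *
        ∑ k : Fin 3, uBar r ν Φ s x k * pD k (φ s) x)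
    (hJx : ∀ s ∈ Set.Icc (0 : ℝ) τ, Integrable fun x : T3 => ∑ k : Fin 3, jKinBar σ r f ν Φ s x k * pD k (φ s) x) :
    fluxGapEns σ r τ φ f ν Φ =
      ∫ s in Set.Icc (0 : ℝ) τ, ∫ x : T3,
        ((∑ k : Fin 3, (Hs σ (rhoBar r ν Φ s x) (thetaBar r ν Φ s x) - hKinBar σ r f ν Φ s x) *
            uBar r ν Φ s x k * pD k (φ s) x) -
          ∑ k : Fin 3, (jBar r f s x k - hBar r f s x * uBar r ν Φ s x k) * pD k (φ s) x) := by
  unfold fluxGapEns ensX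
  rw [← integral_sub hXs hJs]
  refine setIntegral_congr_fun measurableSet_Icc fun s hs => ?_
  rw [← integral_sub (hXx s hs) (hJx s hs)]
  refine integral_congr_ae (ae_of_all _ fun x => ?_)
  exact contactK4_integrand_split σ r φ f ν Φ s x

end Summit.AtomisticToContinuum.HydrodynamicLimit.Theorems.LocalSecondLawContact

end
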